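import Mathlib.LinearAlgebra.SymplecticGroup
import HarnessLib

/-!
# The complement of a hyperbolic pair in the standard symplectic module: restriction, the embedding
# `Sp_{2n−2} ↪ Sp_{2n}`, and the last step of Goresky–Tai 2017, Lemma 45

Goresky–Tai, *Real structures on ordinary abelian varieties*, arXiv:1701.07742, Appendix §19.2, proof of Lemma 45, p0044
(verbatim): «It follows that `τ` is `Sp_{2n}(ℤ)` conjugate to a matrix `(A B; C D)` where `A = (1 *; 0 A₁)`, `B = (* *; * B₁)`,
`C = (0 0; 0 C₁)`, `D = (−1 0; * D₁)` and where `(A₁ B₁; C₁ D₁) ∈ GSp_{2n−2}(ℤ)` is an involution with multiplier equal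
to `−1`.  By induction, the involution `τ` is therefore conjugate to such an element where `A₁ = I`, `B₁` is symmetric,
`C₁ = 0` and `D₁ = −I`.  The condition `τ² = I` then implies that `A = I`, `D = −I`, `C = 0` and `B` is symmetric.»

## What is formalized (the matrix toolkit of this induction step, over any commutative ring `R`)

Index set `Option m ⊕ Option m` (`n = #m + 1`); the distinguished hyperbolic pair is `(e_1, f_1) = (inl none, inr none)`
and its complement is embedded by `E = Sum.map some some : m ⊕ m → Option m ⊕ Option m`; `X|_E = X.submatrix E E`;
`J = Matrix.J _ R = (0 −1; 1 0)`, `Sp = Matrix.symplecticGroup _ R`.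

* §1 `submatrix_mul_optionPair` (`(MN)|_E = M|_E N|_E +` the two rank-one corrections through the pair),
  `submatrix_J_optionPair` (`J|_E = J`);
* §2 «lifts» `H` of `h` — `H|_E = h` with the pair rows and columns of `1` (the embedding `δ : Sp_{2n−2} ↪ Sp_{2n}` as the
  stabiliser of `e_1, f_1`): `exists_lift`, `submatrix_mul_of_pair_rows` / `_cols`, ★ `mem_symplecticGroup_of_pair`
  (`h ∈ Sp_{2n−2} ⟹ H ∈ Sp_{2n}`), `mul_eq_one_of_pair` (`h′h = 1 ⟹ H′H = 1`), ★ `submatrix_conj_of_pair`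
  (`(H′τH)|_E = h′ τ|_E h` — «`(A₁ B₁; C₁ D₁)` … By induction»), ★ `pair_shape_conj` (the shape «`A = (1 *; 0 A₁)`,
  `C = (0 0; 0 C₁)`, `D = (−1 0; * D₁)`», i.e. `τe_1 = e_1` and `(inr none)`-row `−ᵗf_1`, is preserved under `τ ↦ H′τH`);
* §3 ★ `eq_upperInvolution_of_pair_shape` — «The condition `τ² = I` then implies that `A = I`, `D = −I`, `C = 0`»: if
  `τ² = 1`, `τe_1 = e_1`, row `−ᵗf_1`, and `τ|_E = (1 B₁; 0 −1)`, then `τ = (1 B; 0 −1)` (`2` a non-zero-divisor in `R`).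

The induction itself (over `ℤ`, with the tree's `IntegerSymplecticGroupPrimitiveVectors` for the first step and
`IntegerSymplecticUpperInvolutionNormalForm` for the normal forms of `B`) is assembled in a sibling file.  That the
restriction `τ|_E` of such a `τ` is again an involution of multiplier `−1` is `submatrix_mul_optionPair` with the vanishing
corrections — spelled out there.  THEOREMS ONLY; no definition, instance, notation or named fact.

## References

* [GoreskyTai2017RealStructuresOrdinary] M. Goresky, Y.-S. Tai, *Real structures on ordinary abelian varieties*,
  arXiv:1701.07742 (2017), Appendix §19.2, proof of Lemma 45.
-/

noncomputable section

open Matrix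

namespace Literature.LinearAlgebra.Matrix

namespace SymplecticPairComplement

variable {R : Type*} [CommRing R] {m : Type*} [Fintype m] [DecidableEq m]

/-! ## §1 Sums and products split along the pair `(inl none, inr none)` and its complement `m ⊕ m ↪ Option m ⊕ Option m` -/

omit [DecidableEq m] in
/-- `Σ_{x : Option m ⊕ Option m} f(x) = f(inl none) + f(inr none) + Σ_{a : m ⊕ m} f(E a)`, `E = Sum.map some some`. [folklore] -/
private theorem sum_optionPair {A : Type*} [AddCommMonoid A] (f : Option m ⊕ Option m → A) :
    ∑ x, f x = f (Sum.inl none) + f (Sum.inr none) + ∑ a : m ⊕ m, f ((Sum.map Option.some Option.some : m ⊕ m → Option m ⊕ Option m) a) := by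
  rw [Fintype.sum_sum_type, Fintype.sum_sum_type, Fintype.sum_option, Fintype.sum_option]
  simp only [Sum.map_inl, Sum.map_inr]
  abel

omit [DecidableEq m] in
/-- **Products restricted to the complement of the pair**: `(MN)|_E = M|_E N|_E + (column `inl none` of `M`) ⊗ (row
`inl none` of `N`) + (column `inr none`) ⊗ (row `inr none`)`. [cite: GoreskyTai2017RealStructuresOrdinary, App. §19.2 proof of Lemma 45 («`(A₁ B₁; C₁ D₁) ∈ GSp_{2n−2}(ℤ)` … By induction»)] -/
theorem submatrix_mul_optionPair (M N : Matrix (Option m ⊕ Option m) (Option m ⊕ Option m) R) :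
    (M * N).submatrix (Sum.map Option.some Option.some : m ⊕ m → Option m ⊕ Option m) (Sum.map Option.some Option.some : m ⊕ m → Option m ⊕ Option m) = M.submatrix (Sum.map Option.some Option.some : m ⊕ m → Option m ⊕ Option m) (Sum.map Option.some Option.some : m ⊕ m → Option m ⊕ Option m) * N.submatrix (Sum.map Option.some Option.some : m ⊕ m → Option m ⊕ Option m) (Sum.map Option.some Option.some : m ⊕ m → Option m ⊕ Option m) +
      vecMulVec (fun a => M ((Sum.map Option.some Option.some : m ⊕ m → Option m ⊕ Option m) a) (Sum.inl none)) (fun b => N (Sum.inl none) ((Sum.map Option.some Option.some : m ⊕ m → Option m ⊕ Option m) b)) +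
      vecMulVec (fun a => M ((Sum.map Option.some Option.some : m ⊕ m → Option m ⊕ Option m) a) (Sum.inr none)) (fun b => N (Sum.inr none) ((Sum.map Option.some Option.some : m ⊕ m → Option m ⊕ Option m) b)) := by
  ext a b
  rw [submatrix_apply, mul_apply, sum_optionPair, Matrix.add_apply, Matrix.add_apply, mul_apply]
  simp only [submatrix_apply, vecMulVec_apply]
  abel

omit [Fintype m] [DecidableEq m] in
/-- `E a` is never one of the two pair indices. [folklore] -/
private theorem map_ne_inl_none (a : m ⊕ m) : (Sum.map Option.some Option.some : m ⊕ m → Option m ⊕ Option m) a ≠ Sum.inl none := by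
  rcases a with i | i <;> simp

omit [Fintype m] [DecidableEq m] in
/-- `E a ≠ inr none`. [folklore] -/
private theorem map_ne_inr_none (a : m ⊕ m) : (Sum.map Option.some Option.some : m ⊕ m → Option m ⊕ Option m) a ≠ Sum.inr none := by
  rcases a with i | i <;> simp

omit [Fintype m] in
/-- The entries `1 (pair) (E b)` vanish. [folklore] -/
private theorem one_inl_none_map (b : m ⊕ m) :
    (1 : Matrix (Option m ⊕ Option m) (Option m ⊕ Option m) R) (Sum.inl none) ((Sum.map Option.some Option.some : m ⊕ m → Option m ⊕ Option m) b) = 0 :=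
  Matrix.one_apply_ne (map_ne_inl_none b).symm

omit [Fintype m] in
/-- `1 (inr none) (E b) = 0`. [folklore] -/
private theorem one_inr_none_map (b : m ⊕ m) :
    (1 : Matrix (Option m ⊕ Option m) (Option m ⊕ Option m) R) (Sum.inr none) ((Sum.map Option.some Option.some : m ⊕ m → Option m ⊕ Option m) b) = 0 :=
  Matrix.one_apply_ne (map_ne_inr_none b).symm

omit [Fintype m] in
/-- `1 (E a) (inl none) = 0`. [folklore] -/
private theorem one_map_inl_none (a : m ⊕ m) :
    (1 : Matrix (Option m ⊕ Option m) (Option m ⊕ Option m) R) ((Sum.map Option.some Option.some : m ⊕ m → Option m ⊕ Option m) a) (Sum.inl none) = 0 :=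
  Matrix.one_apply_ne (map_ne_inl_none a)

omit [Fintype m] in
/-- `1 (E a) (inr none) = 0`. [folklore] -/
private theorem one_map_inr_none (a : m ⊕ m) :
    (1 : Matrix (Option m ⊕ Option m) (Option m ⊕ Option m) R) ((Sum.map Option.some Option.some : m ⊕ m → Option m ⊕ Option m) a) (Sum.inr none) = 0 :=
  Matrix.one_apply_ne (map_ne_inr_none a)

omit [Fintype m] in
/-- `1|_E = 1`. [folklore] -/
private theorem submatrix_one_optionPair :
    (1 : Matrix (Option m ⊕ Option m) (Option m ⊕ Option m) R).submatrix (Sum.map Option.some Option.some : m ⊕ m → Option m ⊕ Option m) (Sum.map Option.some Option.some : m ⊕ m → Option m ⊕ Option m) = 1 := by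
  ext a b
  rw [submatrix_apply, Matrix.one_apply, Matrix.one_apply]
  exact if_congr (Sum.map_injective.2 ⟨Option.some_injective m, Option.some_injective m⟩).eq_iff rfl rfl

omit [Fintype m] in
/-- `J|_E = J` (the complement of a hyperbolic pair in the standard symplectic module is standard).
[cite: GoreskyTai2017RealStructuresOrdinary, App. §19.2 proof of Lemma 45] -/
theorem submatrix_J_optionPair : (Matrix.J (Option m) R).submatrix (Sum.map Option.some Option.some : m ⊕ m → Option m ⊕ Option m) (Sum.map Option.some Option.some : m ⊕ m → Option m ⊕ Option m) = Matrix.J m R := by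
  ext a b
  rcases a with i | i <;> rcases b with j | j <;>
    simp [Matrix.J, fromBlocks_apply₁₁, fromBlocks_apply₁₂, fromBlocks_apply₂₁, fromBlocks_apply₂₂, Matrix.one_apply]

omit [Fintype m] in
/-- The pair rows and columns of `J = (0 −1; 1 0)`. [folklore] -/
private theorem J_inl_none_apply (y : Option m ⊕ Option m) :
    Matrix.J (Option m) R (Sum.inl none) y = -(1 : Matrix (Option m ⊕ Option m) (Option m ⊕ Option m) R) (Sum.inr none) y := by
  rcases y with j | j <;> simp [Matrix.J, fromBlocks_apply₁₁, fromBlocks_apply₁₂, Matrix.one_apply]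

omit [Fintype m] in
/-- Row `inr none` of `J`. [folklore] -/
private theorem J_inr_none_apply (y : Option m ⊕ Option m) :
    Matrix.J (Option m) R (Sum.inr none) y = (1 : Matrix (Option m ⊕ Option m) (Option m ⊕ Option m) R) (Sum.inl none) y := by
  rcases y with j | j <;> simp [Matrix.J, fromBlocks_apply₂₁, fromBlocks_apply₂₂, Matrix.one_apply]

omit [Fintype m] in
/-- Column `inl none` of `J`. [folklore] -/
private theorem J_apply_inl_none (x : Option m ⊕ Option m) :
    Matrix.J (Option m) R x (Sum.inl none) = (1 : Matrix (Option m ⊕ Option m) (Option m ⊕ Option m) R) x (Sum.inr none) := by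
  rcases x with i | i <;> simp [Matrix.J, fromBlocks_apply₁₁, fromBlocks_apply₂₁, Matrix.one_apply]

omit [Fintype m] in
/-- Column `inr none` of `J`. [folklore] -/
private theorem J_apply_inr_none (x : Option m ⊕ Option m) :
    Matrix.J (Option m) R x (Sum.inr none) = -(1 : Matrix (Option m ⊕ Option m) (Option m ⊕ Option m) R) x (Sum.inl none) := by
  rcases x with i | i <;> simp [Matrix.J, fromBlocks_apply₁₂, fromBlocks_apply₂₂, Matrix.one_apply]

/-- Product entries through a column / row which is a (signed) column / row of `1`. [folklore] -/
private theorem mul_apply_of_col_eq_one {n : Type*} [Fintype n] [DecidableEq n] {M N : Matrix n n R} {c c' : n}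
    (h : ∀ k, N k c = (1 : Matrix n n R) k c') (x : n) : (M * N) x c = M x c' := by
  simp only [mul_apply, h]
  rw [← mul_apply, Matrix.mul_one]

/-- Product entries through a column which is minus a column of `1`. [folklore] -/
private theorem mul_apply_of_col_eq_neg_one {n : Type*} [Fintype n] [DecidableEq n] {M N : Matrix n n R} {c c' : n}
    (h : ∀ k, N k c = -(1 : Matrix n n R) k c') (x : n) : (M * N) x c = -M x c' := by
  simp only [mul_apply, h, mul_neg]
  rw [Finset.sum_neg_distrib, ← mul_apply, Matrix.mul_one]

/-- Product entries through a row which is a row of `1`. [folklore] -/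
private theorem mul_apply_of_row_eq_one {n : Type*} [Fintype n] [DecidableEq n] {M N : Matrix n n R} {r r' : n}
    (h : ∀ k, M r k = (1 : Matrix n n R) r' k) (y : n) : (M * N) r y = N r' y := by
  simp only [mul_apply, h]
  rw [← mul_apply, Matrix.one_mul]

/-- Product entries through a row which is minus a row of `1`. [folklore] -/
private theorem mul_apply_of_row_eq_neg_one {n : Type*} [Fintype n] [DecidableEq n] {M N : Matrix n n R} {r r' : n}
    (h : ∀ k, M r k = -(1 : Matrix n n R) r' k) (y : n) : (M * N) r y = -N r' y := by
  simp only [mul_apply, h, neg_mul]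
  rw [Finset.sum_neg_distrib, ← mul_apply, Matrix.one_mul]

/-- `1 x y = 1 y x`. [folklore] -/
private theorem one_apply_comm {n : Type*} [DecidableEq n] (x y : n) : (1 : Matrix n n R) x y = (1 : Matrix n n R) y x := by
  rw [← transpose_apply (1 : Matrix n n R) x y, transpose_one]

omit [CommRing R] [Fintype m] [DecidableEq m] in
/-- Two matrices agree iff they agree on the complement block and on the pair rows and columns. [folklore] -/
private theorem ext_optionPair {X Y : Matrix (Option m ⊕ Option m) (Option m ⊕ Option m) R}
    (hE : X.submatrix (Sum.map Option.some Option.some : m ⊕ m → Option m ⊕ Option m) (Sum.map Option.some Option.some : m ⊕ m → Option m ⊕ Option m) = Y.submatrix (Sum.map Option.some Option.some : m ⊕ m → Option m ⊕ Option m) (Sum.map Option.some Option.some : m ⊕ m → Option m ⊕ Option m))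
    (h1 : ∀ y, X (Sum.inl none) y = Y (Sum.inl none) y) (h2 : ∀ x, X x (Sum.inl none) = Y x (Sum.inl none))
    (h3 : ∀ y, X (Sum.inr none) y = Y (Sum.inr none) y) (h4 : ∀ x, X x (Sum.inr none) = Y x (Sum.inr none)) : X = Y := by
  ext x y
  rcases x with (_ | i) | (_ | i)
  · exact h1 y
  · rcases y with (_ | j) | (_ | j)
    · exact h2 _
    · exact congr_fun (congr_fun hE (Sum.inl i)) (Sum.inl j)
    · exact h4 _
    · exact congr_fun (congr_fun hE (Sum.inl i)) (Sum.inr j)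
  · exact h3 y
  · rcases y with (_ | j) | (_ | j)
    · exact h2 _
    · exact congr_fun (congr_fun hE (Sum.inr i)) (Sum.inl j)
    · exact h4 _
    · exact congr_fun (congr_fun hE (Sum.inr i)) (Sum.inr j)

/-! ## §2 Matrices that are the identity on the pair: the embedding `Sp_{2n−2} ↪ Sp_{2n}` -/

omit [Fintype m] in
/-- **Existence of the lift**: every `h` on `m ⊕ m` extends to `H` on `Option m ⊕ Option m` with `H|_E = h` and identity
pair rows and columns (the embedding `δ : Sp_{2n−2} ↪ Sp_{2n}` as the stabiliser of the hyperbolic pair `(e_1, f_1)`).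
[cite: GoreskyTai2017RealStructuresOrdinary, App. §19.2 proof of Lemma 45 («By induction, the involution `τ` is therefore conjugate to such an element …»)] -/
theorem exists_lift (h : Matrix (m ⊕ m) (m ⊕ m) R) :
    ∃ H : Matrix (Option m ⊕ Option m) (Option m ⊕ Option m) R, H.submatrix (Sum.map Option.some Option.some : m ⊕ m → Option m ⊕ Option m) (Sum.map Option.some Option.some : m ⊕ m → Option m ⊕ Option m) = h ∧
      (∀ y, H (Sum.inl none) y = (1 : Matrix (Option m ⊕ Option m) (Option m ⊕ Option m) R) (Sum.inl none) y) ∧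
      (∀ x, H x (Sum.inl none) = (1 : Matrix (Option m ⊕ Option m) (Option m ⊕ Option m) R) x (Sum.inl none)) ∧
      (∀ y, H (Sum.inr none) y = (1 : Matrix (Option m ⊕ Option m) (Option m ⊕ Option m) R) (Sum.inr none) y) ∧
      (∀ x, H x (Sum.inr none) = (1 : Matrix (Option m ⊕ Option m) (Option m ⊕ Option m) R) x (Sum.inr none)) := by
  refine ⟨Matrix.of fun x y =>
    Sum.elim
      (fun i => Sum.elim
        (fun j => i.elim (j.elim 1 fun _ => 0) fun i' => j.elim 0 fun j' => h (Sum.inl i') (Sum.inl j'))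
        (fun j => i.elim 0 fun i' => j.elim 0 fun j' => h (Sum.inl i') (Sum.inr j')) y)
      (fun i => Sum.elim
        (fun j => i.elim 0 fun i' => j.elim 0 fun j' => h (Sum.inr i') (Sum.inl j'))
        (fun j => i.elim (j.elim 1 fun _ => 0) fun i' => j.elim 0 fun j' => h (Sum.inr i') (Sum.inr j')) y) x,
    ?_, ?_, ?_, ?_, ?_⟩
  · ext a b
    rcases a with i | i <;> rcases b with j | j <;> simp
  · rintro ((_ | j) | (_ | j)) <;> simp
  · rintro ((_ | i) | (_ | i)) <;> simp
  · rintro ((_ | j) | (_ | j)) <;> simp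
  · rintro ((_ | i) | (_ | i)) <;> simp

variable {H H' τ : Matrix (Option m ⊕ Option m) (Option m ⊕ Option m) R}

omit [DecidableEq m] in
/-- Entrywise form of `submatrix_mul_optionPair`. [folklore] -/
private theorem submatrix_mul_apply_optionPair (M N : Matrix (Option m ⊕ Option m) (Option m ⊕ Option m) R) (a b : m ⊕ m) :
    (M * N) ((Sum.map Option.some Option.some : m ⊕ m → Option m ⊕ Option m) a) ((Sum.map Option.some Option.some : m ⊕ m → Option m ⊕ Option m) b) = (M.submatrix (Sum.map Option.some Option.some : m ⊕ m → Option m ⊕ Option m) (Sum.map Option.some Option.some : m ⊕ m → Option m ⊕ Option m) * N.submatrix (Sum.map Option.some Option.some : m ⊕ m → Option m ⊕ Option m) (Sum.map Option.some Option.some : m ⊕ m → Option m ⊕ Option m)) a b +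
      M ((Sum.map Option.some Option.some : m ⊕ m → Option m ⊕ Option m) a) (Sum.inl none) * N (Sum.inl none) ((Sum.map Option.some Option.some : m ⊕ m → Option m ⊕ Option m) b) + M ((Sum.map Option.some Option.some : m ⊕ m → Option m ⊕ Option m) a) (Sum.inr none) * N (Sum.inr none) ((Sum.map Option.some Option.some : m ⊕ m → Option m ⊕ Option m) b) := by
  have h := congr_fun (congr_fun (submatrix_mul_optionPair M N) a) b
  simpa only [submatrix_apply, Matrix.add_apply, vecMulVec_apply] using h

/-- **Restriction of a product through a matrix with identity pair rows**: `(MH)|_E = M|_E H|_E` when the pair rows of `H`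
are those of `1`. [cite: GoreskyTai2017RealStructuresOrdinary, App. §19.2 proof of Lemma 45] -/
theorem submatrix_mul_of_pair_rows (M : Matrix (Option m ⊕ Option m) (Option m ⊕ Option m) R)
    (h1 : ∀ y, H (Sum.inl none) y = (1 : Matrix (Option m ⊕ Option m) (Option m ⊕ Option m) R) (Sum.inl none) y)
    (h3 : ∀ y, H (Sum.inr none) y = (1 : Matrix (Option m ⊕ Option m) (Option m ⊕ Option m) R) (Sum.inr none) y) :
    (M * H).submatrix (Sum.map Option.some Option.some : m ⊕ m → Option m ⊕ Option m) (Sum.map Option.some Option.some : m ⊕ m → Option m ⊕ Option m) = M.submatrix (Sum.map Option.some Option.some : m ⊕ m → Option m ⊕ Option m) (Sum.map Option.some Option.some : m ⊕ m → Option m ⊕ Option m) * H.submatrix (Sum.map Option.some Option.some : m ⊕ m → Option m ⊕ Option m) (Sum.map Option.some Option.some : m ⊕ m → Option m ⊕ Option m) := by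
  ext a b
  rw [submatrix_apply, submatrix_mul_apply_optionPair, h1, h3, one_inl_none_map, one_inr_none_map, mul_zero, mul_zero,
    add_zero, add_zero]

/-- `(HM)|_E = H|_E M|_E` when the pair columns of `H` are those of `1`. [cite: GoreskyTai2017RealStructuresOrdinary, App. §19.2 proof of Lemma 45] -/
theorem submatrix_mul_of_pair_cols (M : Matrix (Option m ⊕ Option m) (Option m ⊕ Option m) R)
    (h2 : ∀ x, H x (Sum.inl none) = (1 : Matrix (Option m ⊕ Option m) (Option m ⊕ Option m) R) x (Sum.inl none))
    (h4 : ∀ x, H x (Sum.inr none) = (1 : Matrix (Option m ⊕ Option m) (Option m ⊕ Option m) R) x (Sum.inr none)) :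
    (H * M).submatrix (Sum.map Option.some Option.some : m ⊕ m → Option m ⊕ Option m) (Sum.map Option.some Option.some : m ⊕ m → Option m ⊕ Option m) = H.submatrix (Sum.map Option.some Option.some : m ⊕ m → Option m ⊕ Option m) (Sum.map Option.some Option.some : m ⊕ m → Option m ⊕ Option m) * M.submatrix (Sum.map Option.some Option.some : m ⊕ m → Option m ⊕ Option m) (Sum.map Option.some Option.some : m ⊕ m → Option m ⊕ Option m) := by
  ext a b
  rw [submatrix_apply, submatrix_mul_apply_optionPair, h2, h4, one_map_inl_none, one_map_inr_none, zero_mul, zero_mul,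
    add_zero, add_zero]

/-- **The lift of a symplectic matrix is symplectic**: `H|_E ∈ Sp_{2n−2}` with identity pair rows/columns ⟹ `H ∈ Sp_{2n}`
(the embedding `δ : Sp_{2n−2} ↪ Sp_{2n}`). [cite: GoreskyTai2017RealStructuresOrdinary, App. §19.2 proof of Lemma 45] -/
theorem mem_symplecticGroup_of_pair (hh : H.submatrix (Sum.map Option.some Option.some : m ⊕ m → Option m ⊕ Option m) (Sum.map Option.some Option.some : m ⊕ m → Option m ⊕ Option m) ∈ Matrix.symplecticGroup m R)
    (h1 : ∀ y, H (Sum.inl none) y = (1 : Matrix (Option m ⊕ Option m) (Option m ⊕ Option m) R) (Sum.inl none) y)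
    (h2 : ∀ x, H x (Sum.inl none) = (1 : Matrix (Option m ⊕ Option m) (Option m ⊕ Option m) R) x (Sum.inl none))
    (h3 : ∀ y, H (Sum.inr none) y = (1 : Matrix (Option m ⊕ Option m) (Option m ⊕ Option m) R) (Sum.inr none) y)
    (h4 : ∀ x, H x (Sum.inr none) = (1 : Matrix (Option m ⊕ Option m) (Option m ⊕ Option m) R) x (Sum.inr none)) :
    H ∈ Matrix.symplecticGroup (Option m) R := by
  rw [SymplecticGroup.mem_iff'] at hh ⊢
  have ht1 : ∀ k, Hᵀ (Sum.inl none) k = (1 : Matrix (Option m ⊕ Option m) (Option m ⊕ Option m) R) (Sum.inl none) k := fun k => by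
    rw [transpose_apply, h2, one_apply_comm]
  have ht3 : ∀ k, Hᵀ (Sum.inr none) k = (1 : Matrix (Option m ⊕ Option m) (Option m ⊕ Option m) R) (Sum.inr none) k := fun k => by
    rw [transpose_apply, h4, one_apply_comm]
  -- pair rows / columns of `ᵗH J`
  have r1 : ∀ k, (Hᵀ * Matrix.J (Option m) R) (Sum.inl none) k = -(1 : Matrix (Option m ⊕ Option m) (Option m ⊕ Option m) R) (Sum.inr none) k := fun k => by
    rw [mul_apply_of_row_eq_one ht1, J_inl_none_apply]
  have r3 : ∀ k, (Hᵀ * Matrix.J (Option m) R) (Sum.inr none) k = (1 : Matrix (Option m ⊕ Option m) (Option m ⊕ Option m) R) (Sum.inl none) k := fun k => by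
    rw [mul_apply_of_row_eq_one ht3, J_inr_none_apply]
  have c2 : ∀ x, (Hᵀ * Matrix.J (Option m) R) x (Sum.inl none) = (1 : Matrix (Option m ⊕ Option m) (Option m ⊕ Option m) R) x (Sum.inr none) := fun x => by
    rw [mul_apply_of_col_eq_one (c' := Sum.inr none) (fun k => J_apply_inl_none k), transpose_apply, h3, one_apply_comm]
  have c4 : ∀ x, (Hᵀ * Matrix.J (Option m) R) x (Sum.inr none) = -(1 : Matrix (Option m ⊕ Option m) (Option m ⊕ Option m) R) x (Sum.inl none) := fun x => by
    rw [mul_apply_of_col_eq_neg_one (c' := Sum.inl none) (fun k => J_apply_inr_none k), transpose_apply, h1, one_apply_comm]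
  refine ext_optionPair ?_ (fun y => ?_) (fun x => ?_) (fun y => ?_) (fun x => ?_)
  · rw [submatrix_mul_of_pair_rows _ h1 h3, submatrix_J_optionPair]
    have hE : (Hᵀ * Matrix.J (Option m) R).submatrix (Sum.map Option.some Option.some : m ⊕ m → Option m ⊕ Option m) (Sum.map Option.some Option.some : m ⊕ m → Option m ⊕ Option m) = (H.submatrix (Sum.map Option.some Option.some : m ⊕ m → Option m ⊕ Option m) (Sum.map Option.some Option.some : m ⊕ m → Option m ⊕ Option m))ᵀ * Matrix.J m R := by
      ext a b
      rw [submatrix_apply, submatrix_mul_apply_optionPair, J_inl_none_apply, J_inr_none_apply, one_inr_none_map,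
        one_inl_none_map, neg_zero, mul_zero, mul_zero, add_zero, add_zero, transpose_submatrix, submatrix_J_optionPair]
    rw [hE, hh]
  · rw [mul_apply_of_row_eq_neg_one r1, h3, J_inl_none_apply]
  · rw [mul_apply_of_col_eq_one h2, c2, J_apply_inl_none]
  · rw [mul_apply_of_row_eq_one r3, h1, J_inr_none_apply]
  · rw [mul_apply_of_col_eq_one h4, c4, J_apply_inr_none]

/-- **Lifts multiply**: if `H′|_E H|_E = 1` then `H′H = 1` (identity pair rows/columns).
[cite: GoreskyTai2017RealStructuresOrdinary, App. §19.2 proof of Lemma 45] -/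
theorem mul_eq_one_of_pair (hh : H'.submatrix (Sum.map Option.some Option.some : m ⊕ m → Option m ⊕ Option m) (Sum.map Option.some Option.some : m ⊕ m → Option m ⊕ Option m) * H.submatrix (Sum.map Option.some Option.some : m ⊕ m → Option m ⊕ Option m) (Sum.map Option.some Option.some : m ⊕ m → Option m ⊕ Option m) = 1)
    (h1 : ∀ y, H (Sum.inl none) y = (1 : Matrix (Option m ⊕ Option m) (Option m ⊕ Option m) R) (Sum.inl none) y)
    (h2 : ∀ x, H x (Sum.inl none) = (1 : Matrix (Option m ⊕ Option m) (Option m ⊕ Option m) R) x (Sum.inl none))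
    (h3 : ∀ y, H (Sum.inr none) y = (1 : Matrix (Option m ⊕ Option m) (Option m ⊕ Option m) R) (Sum.inr none) y)
    (h4 : ∀ x, H x (Sum.inr none) = (1 : Matrix (Option m ⊕ Option m) (Option m ⊕ Option m) R) x (Sum.inr none))
    (h1' : ∀ y, H' (Sum.inl none) y = (1 : Matrix (Option m ⊕ Option m) (Option m ⊕ Option m) R) (Sum.inl none) y)
    (h2' : ∀ x, H' x (Sum.inl none) = (1 : Matrix (Option m ⊕ Option m) (Option m ⊕ Option m) R) x (Sum.inl none))
    (h3' : ∀ y, H' (Sum.inr none) y = (1 : Matrix (Option m ⊕ Option m) (Option m ⊕ Option m) R) (Sum.inr none) y)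
    (h4' : ∀ x, H' x (Sum.inr none) = (1 : Matrix (Option m ⊕ Option m) (Option m ⊕ Option m) R) x (Sum.inr none)) :
    H' * H = 1 := by
  refine ext_optionPair ?_ (fun y => ?_) (fun x => ?_) (fun y => ?_) (fun x => ?_)
  · rw [submatrix_mul_of_pair_rows _ h1 h3, hh, submatrix_one_optionPair]
  · rw [mul_apply_of_row_eq_one h1', h1]
  · rw [mul_apply_of_col_eq_one h2, h2']
  · rw [mul_apply_of_row_eq_one h3', h3]
  · rw [mul_apply_of_col_eq_one h4, h4']

/-- **Conjugation restricts**: `(H′τH)|_E = H′|_E τ|_E H|_E` for lifts `H, H′` (identity pair rows/columns) and ANY `τ`.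
[cite: GoreskyTai2017RealStructuresOrdinary, App. §19.2 proof of Lemma 45] -/
theorem submatrix_conj_of_pair
    (h1 : ∀ y, H (Sum.inl none) y = (1 : Matrix (Option m ⊕ Option m) (Option m ⊕ Option m) R) (Sum.inl none) y)
    (h3 : ∀ y, H (Sum.inr none) y = (1 : Matrix (Option m ⊕ Option m) (Option m ⊕ Option m) R) (Sum.inr none) y)
    (h2' : ∀ x, H' x (Sum.inl none) = (1 : Matrix (Option m ⊕ Option m) (Option m ⊕ Option m) R) x (Sum.inl none))
    (h4' : ∀ x, H' x (Sum.inr none) = (1 : Matrix (Option m ⊕ Option m) (Option m ⊕ Option m) R) x (Sum.inr none)) :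
    (H' * τ * H).submatrix (Sum.map Option.some Option.some : m ⊕ m → Option m ⊕ Option m) (Sum.map Option.some Option.some : m ⊕ m → Option m ⊕ Option m) = H'.submatrix (Sum.map Option.some Option.some : m ⊕ m → Option m ⊕ Option m) (Sum.map Option.some Option.some : m ⊕ m → Option m ⊕ Option m) * τ.submatrix (Sum.map Option.some Option.some : m ⊕ m → Option m ⊕ Option m) (Sum.map Option.some Option.some : m ⊕ m → Option m ⊕ Option m) * H.submatrix (Sum.map Option.some Option.some : m ⊕ m → Option m ⊕ Option m) (Sum.map Option.some Option.some : m ⊕ m → Option m ⊕ Option m) := by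
  rw [submatrix_mul_of_pair_rows _ h1 h3, submatrix_mul_of_pair_cols _ h2' h4']

/-- **Shape transport**: if `τe_1 = e_1` (column `inl none` of `τ` is that of `1`) and the `(inr none)`-row of `τ` is
`−ᵗf_1`, the same holds for `H′τH`. [cite: GoreskyTai2017RealStructuresOrdinary, App. §19.2 proof of Lemma 45] -/
theorem pair_shape_conj
    (hc : ∀ x, τ x (Sum.inl none) = (1 : Matrix (Option m ⊕ Option m) (Option m ⊕ Option m) R) x (Sum.inl none))
    (hr : ∀ y, τ (Sum.inr none) y = -(1 : Matrix (Option m ⊕ Option m) (Option m ⊕ Option m) R) (Sum.inr none) y)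
    (h2 : ∀ x, H x (Sum.inl none) = (1 : Matrix (Option m ⊕ Option m) (Option m ⊕ Option m) R) x (Sum.inl none))
    (h3 : ∀ y, H (Sum.inr none) y = (1 : Matrix (Option m ⊕ Option m) (Option m ⊕ Option m) R) (Sum.inr none) y)
    (h2' : ∀ x, H' x (Sum.inl none) = (1 : Matrix (Option m ⊕ Option m) (Option m ⊕ Option m) R) x (Sum.inl none))
    (h3' : ∀ y, H' (Sum.inr none) y = (1 : Matrix (Option m ⊕ Option m) (Option m ⊕ Option m) R) (Sum.inr none) y) :
    (∀ x, (H' * τ * H) x (Sum.inl none) = (1 : Matrix (Option m ⊕ Option m) (Option m ⊕ Option m) R) x (Sum.inl none)) ∧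
      ∀ y, (H' * τ * H) (Sum.inr none) y = -(1 : Matrix (Option m ⊕ Option m) (Option m ⊕ Option m) R) (Sum.inr none) y := by
  constructor
  · intro x
    rw [mul_apply_of_col_eq_one h2, mul_apply_of_col_eq_one hc, h2']
  · intro y
    have hr' : ∀ k, (H' * τ) (Sum.inr none) k = -(1 : Matrix (Option m ⊕ Option m) (Option m ⊕ Option m) R) (Sum.inr none) k := fun k => by
      rw [mul_apply_of_row_eq_one h3', hr]
    rw [mul_apply_of_row_eq_neg_one hr', h3]

/-! ## §3 «The condition `τ² = I` then implies that `A = I`, `D = −I`, `C = 0`» -/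

/-- **The last step of the printed proof**: an involution `τ` (`τ² = 1`) with `τe_1 = e_1`, `(inr none)`-row `−ᵗf_1`
and restriction `τ|_E = (1 B₁; 0 −1)` to the complement of the pair is itself `(1 B; 0 −1)` (`B_{ij} = τ_{inl i, inr j}`)
— «The condition `τ² = I` then implies that `A = I`, `D = −I`, `C = 0` and `B` is symmetric» (symmetry of `B` then
follows from the multiplier, tree `transpose_upperInvolution_mul_J_mul_eq_neg_J_iff`); `2` must be a non-zero-divisor.
[cite: GoreskyTai2017RealStructuresOrdinary, App. §19.2 proof of Lemma 45] -/
theorem eq_upperInvolution_of_pair_shape [NoZeroDivisors R] (htwo : (2 : R) ≠ 0) (hττ : τ * τ = 1)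
    (hc : ∀ x, τ x (Sum.inl none) = (1 : Matrix (Option m ⊕ Option m) (Option m ⊕ Option m) R) x (Sum.inl none))
    (hr : ∀ y, τ (Sum.inr none) y = -(1 : Matrix (Option m ⊕ Option m) (Option m ⊕ Option m) R) (Sum.inr none) y)
    {B₁ : Matrix m m R} (hE : τ.submatrix (Sum.map Option.some Option.some : m ⊕ m → Option m ⊕ Option m) (Sum.map Option.some Option.some : m ⊕ m → Option m ⊕ Option m) = fromBlocks 1 B₁ 0 (-1)) :
    τ = fromBlocks 1 (Matrix.of fun i j => τ (Sum.inl i) (Sum.inr j)) 0 (-1) := by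
  -- entries of the restriction
  have hA : ∀ i j : m, τ (Sum.inl (some i)) (Sum.inl (some j)) = (1 : Matrix m m R) i j := fun i j => by
    have h := congr_fun (congr_fun hE (Sum.inl i)) (Sum.inl j)
    rwa [submatrix_apply, Sum.map_inl, Sum.map_inl, fromBlocks_apply₁₁] at h
  have hC : ∀ i j : m, τ (Sum.inr (some i)) (Sum.inl (some j)) = 0 := fun i j => by
    have h := congr_fun (congr_fun hE (Sum.inr i)) (Sum.inl j)
    rwa [submatrix_apply, Sum.map_inr, Sum.map_inl, fromBlocks_apply₂₁, Matrix.zero_apply] at h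
  have hD : ∀ i j : m, τ (Sum.inr (some i)) (Sum.inr (some j)) = -(1 : Matrix m m R) i j := fun i j => by
    have h := congr_fun (congr_fun hE (Sum.inr i)) (Sum.inr j)
    rwa [submatrix_apply, Sum.map_inr, Sum.map_inr, fromBlocks_apply₂₂, Matrix.neg_apply] at h
  -- the whole `C` block vanishes
  have hC' : ∀ i j : Option m, τ (Sum.inr i) (Sum.inl j) = 0 := by
    rintro (_ | i) (_ | j)
    · rw [hr]; simp
    · rw [hr]; simp
    · rw [hc]; simp
    · exact hC i j
  -- `a_j = τ_{inl none, inl (some j)} = 0` from `τ² = 1`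
  have ha : ∀ j : m, τ (Sum.inl none) (Sum.inl (some j)) = 0 := fun j => by
    have h := congr_fun (congr_fun hττ (Sum.inl none)) (Sum.inl (some j))
    rw [mul_apply, sum_optionPair, Matrix.one_apply_ne (by simp), hC', mul_zero, add_zero, hc,
      Matrix.one_apply_eq, one_mul, Fintype.sum_sum_type] at h
    simp only [Sum.map_inl, Sum.map_inr, hC', mul_zero, Finset.sum_const_zero, add_zero, hA, Matrix.one_apply, mul_ite,
      mul_one, mul_zero, Finset.sum_ite_eq', Finset.mem_univ, if_true] at h
    have h2 : (2 : R) * τ (Sum.inl none) (Sum.inl (some j)) = 0 := by rw [two_mul]; exact h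
    exact (mul_eq_zero.1 h2).resolve_left htwo
  -- `d_i = τ_{inr (some i), inr none} = 0` from `τ² = 1`
  have hd : ∀ i : m, τ (Sum.inr (some i)) (Sum.inr none) = 0 := fun i => by
    have h := congr_fun (congr_fun hττ (Sum.inr (some i))) (Sum.inr none)
    rw [mul_apply, sum_optionPair, Matrix.one_apply_ne (by simp), hC', zero_mul, zero_add, hr, Matrix.one_apply_eq,
      mul_neg, mul_one, Fintype.sum_sum_type] at h
    simp only [Sum.map_inl, Sum.map_inr, hC', zero_mul, Finset.sum_const_zero, zero_add, hD, Matrix.one_apply, neg_ite,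
      ite_mul, neg_mul, one_mul, zero_mul, neg_zero, Finset.sum_ite_eq, Finset.mem_univ, if_true] at h
    have h2 : (2 : R) * τ (Sum.inr (some i)) (Sum.inr none) = 0 := by
      rw [two_mul]; rw [← neg_add, neg_eq_zero] at h; exact h
    exact (mul_eq_zero.1 h2).resolve_left htwo
  -- assemble
  ext x y
  rcases x with (_ | i) | (_ | i) <;> rcases y with (_ | j) | (_ | j)
  · rw [hc, fromBlocks_apply₁₁]; simp
  · rw [ha, fromBlocks_apply₁₁, Matrix.one_apply_ne (by simp)]
  · rw [fromBlocks_apply₁₂, of_apply]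
  · rw [fromBlocks_apply₁₂, of_apply]
  · rw [hc, fromBlocks_apply₁₁]; simp
  · rw [hA, fromBlocks_apply₁₁, Matrix.one_apply, Matrix.one_apply]
    exact if_congr Option.some_inj.symm rfl rfl
  · rw [fromBlocks_apply₁₂, of_apply]
  · rw [fromBlocks_apply₁₂, of_apply]
  · rw [hC', fromBlocks_apply₂₁, Matrix.zero_apply]
  · rw [hC', fromBlocks_apply₂₁, Matrix.zero_apply]
  · rw [hr, fromBlocks_apply₂₂]; simp
  · rw [hr, fromBlocks_apply₂₂]; simp
  · rw [hC', fromBlocks_apply₂₁, Matrix.zero_apply]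
  · rw [hC', fromBlocks_apply₂₁, Matrix.zero_apply]
  · rw [hd, fromBlocks_apply₂₂, Matrix.neg_apply, Matrix.one_apply_ne (by simp), neg_zero]
  · rw [hD, fromBlocks_apply₂₂, Matrix.neg_apply, Matrix.one_apply, Matrix.one_apply]
    exact congrArg Neg.neg (if_congr Option.some_inj.symm rfl rfl)

end SymplecticPairComplement

end Literature.LinearAlgebra.Matrix
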